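import Mathlib
import HarnessLib

/-!
# Two-scale window contractions of the fibre line

(Line `janus-bands`, crux `ArrangementNormalForm`, stub `stub_separateTwo`, part `Window`.)
The reparametrisations fed into the fibre-mass comparison lemma (`SepTwo.lmass_comp_le`, part
`Comparison`) when two nearby base points are compared: the WINDOW CONTRACTION `wmap m ℓ ρ s`
contracts the core `|τ − m| ≤ ℓ` affinely by `s ∈ (0, 1]` about `m`, is the identity off the
window `|τ − m| < ρ` (`ρ ≥ 2ℓ`), and interpolates on the buffer by the power law
`ρ (|τ−m|/ρ)^a`, `a = wexp ℓ ρ s = 1 + log(1/s)/log(ρ/ℓ)` (log-log-linear). It is a strictly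
increasing surjection, differentiable off `|τ − m| ∈ {ℓ, ρ}` with `0 ≤ wmap' ≤ a`, and satisfies
the RATIO condition of the comparison lemma with constant `3a` for letters in the half core
`|γ − m| ≤ ℓ/2` or at distance `≥ 3ρ` (`separateTwo_window`): contracting a cluster of atoms by
`s` costs a factor `(3a)^k = O((1 + log(1/s))^k)` on the fibre mass.
-/

noncomputable section

open Set
namespace Summit.KontsevichZagierPeriods.ArrangementNormalForm.JanusBands

namespace SepTwo

/-- The buffer exponent `a = 1 − log s / log(ρ/ℓ)`. -/
def wexp (ℓ ρ s : ℝ) : ℝ := 1 - Real.log s / Real.log (ρ / ℓ)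

/-- The radial profile on `u ≥ 0`: `s u` on the core, `ρ (u/ρ)^a` on the buffer, `u` outside. -/
def wg (ℓ ρ s u : ℝ) : ℝ :=
  if u ≤ ℓ then s * u else if ρ ≤ u then u else ρ * (u / ρ) ^ wexp ℓ ρ s

/-- The odd extension of the radial profile: the window contraction centred at `0`. -/
def wk (ℓ ρ s v : ℝ) : ℝ := if 0 ≤ v then wg ℓ ρ s v else -wg ℓ ρ s (-v)

/-- Its derivative off the break points `|v| ∈ {ℓ, ρ}`. -/
def wkD (ℓ ρ s v : ℝ) : ℝ :=
  if |v| < ℓ then s else if |v| < ρ then wexp ℓ ρ s * (|v| / ρ) ^ (wexp ℓ ρ s - 1) else 1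

/-- The window contraction centred at `m`. -/
def wmap (m ℓ ρ s τ : ℝ) : ℝ := m + wk ℓ ρ s (τ - m)

/-- Its derivative off the break points `|τ − m| ∈ {ℓ, ρ}`. -/
def wmapD (m ℓ ρ s τ : ℝ) : ℝ := wkD ℓ ρ s (τ - m)

/-- The profile on the core. -/
theorem wg_eq_lo {ℓ ρ s u : ℝ} (hu : u ≤ ℓ) : wg ℓ ρ s u = s * u := by unfold wg; rw [if_pos hu]

section Facts

variable {ℓ ρ s : ℝ} (h : 0 < ℓ ∧ 2 * ℓ ≤ ρ ∧ 0 < s ∧ s ≤ 1)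
include h

/-- `log(ρ/ℓ) > 0`. -/
theorem log_ratio_pos : 0 < Real.log (ρ / ℓ) := by
  have ⟨hℓ, hρ, hs0, hs1⟩ := h; exact Real.log_pos ((one_lt_div hℓ).2 (by linarith))

/-- `1 ≤ a`. -/
theorem one_le_wexp : 1 ≤ wexp ℓ ρ s := by
  have ⟨hℓ, hρ, hs0, hs1⟩ := h
  have h' := div_nonpos_of_nonpos_of_nonneg (Real.log_nonpos hs0.le hs1) (log_ratio_pos h).le
  unfold wexp; linarith

/-- The calibration of the exponent: `(ℓ/ρ)^(a−1) = s`. -/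
theorem rpow_wexp_sub_one : (ℓ / ρ) ^ (wexp ℓ ρ s - 1) = s := by
  have ⟨hℓ, hρ, hs0, hs1⟩ := h; have hρ0 : 0 < ρ := by linarith
  have hL := log_ratio_pos h
  rw [Real.rpow_def_of_pos (div_pos hℓ hρ0), Real.log_div hℓ.ne' hρ0.ne']
  have h1 : Real.log (ρ / ℓ) = Real.log ρ - Real.log ℓ := Real.log_div hρ0.ne' hℓ.ne'
  have h2 : (Real.log ℓ - Real.log ρ) * (wexp ℓ ρ s - 1) = Real.log s := by
    unfold wexp; rw [h1] at hL ⊢; field_simp; ring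
  rw [h2, Real.exp_log hs0]

/-- The profile on the closed buffer. -/
theorem wg_eq_mid {u : ℝ} (hu1 : ℓ ≤ u) (hu2 : u ≤ ρ) : wg ℓ ρ s u = ρ * (u / ρ) ^ wexp ℓ ρ s := by
  have ⟨hℓ, hρ, hs0, hs1⟩ := h; have hρ0 : 0 < ρ := by linarith
  unfold wg
  rcases hu1.lt_or_eq with hlt | heq
  · rw [if_neg (not_le.2 hlt)]
    rcases hu2.lt_or_eq with hlt' | heq'
    · rw [if_neg (not_le.2 hlt')]
    · rw [if_pos heq'.ge, heq', div_self hρ0.ne', Real.one_rpow, mul_one]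
  · subst heq
    rw [if_pos le_rfl]
    have h' : (ℓ / ρ) ^ wexp ℓ ρ s = s * (ℓ / ρ) := by
      conv_lhs => rw [show wexp ℓ ρ s = (wexp ℓ ρ s - 1) + 1 by ring]
      rw [Real.rpow_add (div_pos hℓ hρ0), rpow_wexp_sub_one h, Real.rpow_one]
    rw [h']; field_simp

/-- The profile outside the window. -/
theorem wg_eq_hi {u : ℝ} (hu : ρ ≤ u) : wg ℓ ρ s u = u := by
  have ⟨hℓ, hρ, hs0, hs1⟩ := h; unfold wg; rw [if_neg (by linarith), if_pos hu]

/-- The profile is strictly increasing on `u ≥ 0`. -/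
theorem strictMonoOn_wg : StrictMonoOn (wg ℓ ρ s) (Ici 0) := by
  have ⟨hℓ, hρ, hs0, hs1⟩ := h; have hρ0 : 0 < ρ := by linarith
  have ha : 0 < wexp ℓ ρ s := by linarith [one_le_wexp h]
  have h1 : StrictMonoOn (wg ℓ ρ s) (Icc 0 ℓ) := fun u hu v hv huv => by
    rw [wg_eq_lo hu.2, wg_eq_lo hv.2]
    exact mul_lt_mul_of_pos_left huv hs0
  have h2 : StrictMonoOn (wg ℓ ρ s) (Icc ℓ ρ) := fun u hu v hv huv => by
    rw [wg_eq_mid h hu.1 hu.2, wg_eq_mid h hv.1 hv.2]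
    refine mul_lt_mul_of_pos_left (Real.rpow_lt_rpow ?_ ?_ ha) hρ0
    · exact div_nonneg (by linarith [hu.1]) hρ0.le
    · exact div_lt_div_of_pos_right huv hρ0
  have h3 : StrictMonoOn (wg ℓ ρ s) (Ici ρ) := fun u hu v hv huv => by
    rw [wg_eq_hi h (mem_Ici.1 hu), wg_eq_hi h (mem_Ici.1 hv)]; exact huv
  have h12 := h1.union h2 (isGreatest_Icc hℓ.le) (isLeast_Icc (by linarith))
  rw [Icc_union_Icc_eq_Icc hℓ.le (by linarith)] at h12
  have h123 := h12.union h3 (isGreatest_Icc hρ0.le) isLeast_Ici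
  rwa [Icc_union_Ici_eq_Ici hρ0.le] at h123

/-- `wg 0 = 0`. -/
theorem wg_zero : wg ℓ ρ s 0 = 0 := by rw [wg_eq_lo h.1.le, mul_zero]
/-- The profile is positive on `u > 0`. -/
theorem wg_pos {u : ℝ} (hu : 0 < u) : 0 < wg ℓ ρ s u := by
  have ⟨hℓ, hρ, hs0, hs1⟩ := h; have h' := strictMonoOn_wg h (mem_Ici.2 le_rfl) (mem_Ici.2 hu.le) hu
  rwa [wg_zero h] at h'

/-- The profile is nonnegative on `u ≥ 0`. -/
theorem wg_nonneg {u : ℝ} (hu : 0 ≤ u) : 0 ≤ wg ℓ ρ s u := by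
  have ⟨hℓ, hρ, hs0, hs1⟩ := h; rcases hu.lt_or_eq with h' | h'
  · exact (wg_pos h h').le
  · rw [← h', wg_zero h]

/-- The profile is a contraction: `wg u ≤ u` on `u ≥ 0`. -/
theorem wg_le_self {u : ℝ} (hu : 0 ≤ u) : wg ℓ ρ s u ≤ u := by
  have ⟨hℓ, hρ, hs0, hs1⟩ := h; have hρ0 : 0 < ρ := by linarith
  by_cases h1 : u ≤ ℓ
  · rw [wg_eq_lo h1]; nlinarith
  by_cases h2 : ρ ≤ u
  · rw [wg_eq_hi h h2]
  push Not at h1 h2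
  rw [wg_eq_mid h h1.le h2.le]
  have hq : 0 < u / ρ := div_pos (by linarith) hρ0
  have h' : (u / ρ) ^ wexp ℓ ρ s ≤ (u / ρ) ^ (1 : ℝ) :=
    Real.rpow_le_rpow_of_exponent_ge hq ((div_le_one hρ0).2 h2.le) (one_le_wexp h)
  rw [Real.rpow_one] at h'
  calc ρ * (u / ρ) ^ wexp ℓ ρ s ≤ ρ * (u / ρ) := mul_le_mul_of_nonneg_left h' hρ0.le
    _ = u := by field_simp

/-- Beyond the core the profile is at least `s ℓ`. -/
theorem sl_le_wg {u : ℝ} (hu : ℓ ≤ u) : s * ℓ ≤ wg ℓ ρ s u := by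
  have ⟨hℓ, hρ, hs0, hs1⟩ := h
  have h' := (strictMonoOn_wg h).monotoneOn (mem_Ici.2 hℓ.le) (mem_Ici.2 (hℓ.le.trans hu)) hu
  rwa [wg_eq_lo le_rfl] at h'

/-- The profile is continuous. -/
theorem continuous_wg : Continuous (wg ℓ ρ s) := by
  have ⟨hℓ, hρ, hs0, hs1⟩ := h; have hρ0 : 0 < ρ := by linarith
  have ha : 0 ≤ wexp ℓ ρ s := by linarith [one_le_wexp h]
  have hb : Continuous fun u : ℝ => ρ * (u / ρ) ^ wexp ℓ ρ s :=
    continuous_const.mul ((Real.continuous_rpow_const ha).comp (continuous_id.div_const ρ))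
  have hin : Continuous fun u : ℝ => if ρ ≤ u then u else ρ * (u / ρ) ^ wexp ℓ ρ s := by
    refine Continuous.if_le continuous_id hb continuous_const continuous_id fun u hu => ?_
    rw [← hu, div_self hρ0.ne', Real.one_rpow, mul_one]
  unfold wg
  refine Continuous.if_le (continuous_const.mul continuous_id) hin continuous_id continuous_const
    fun u hu => ?_
  rw [hu, if_neg (by linarith)]
  have h' := wg_eq_mid h (le_refl ℓ) (by linarith)
  rwa [wg_eq_lo le_rfl] at h'

/-- The window contraction is continuous. -/
theorem continuous_wk : Continuous (wk ℓ ρ s) := by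
  have ⟨hℓ, hρ, hs0, hs1⟩ := h; unfold wk
  refine Continuous.if_le (continuous_wg h)
    ((continuous_wg h).comp continuous_neg).neg continuous_const continuous_id
    fun v hv => ?_
  simp [← hv, wg_zero h]

/-- The window contraction is strictly increasing. -/
theorem strictMono_wk : StrictMono (wk ℓ ρ s) := by
  have ⟨hℓ, hρ, hs0, hs1⟩ := h; have hmono := strictMonoOn_wg h
  intro v w hvw
  unfold wk
  by_cases hv : 0 ≤ v
  · rw [if_pos hv, if_pos (hv.trans hvw.le)]
    exact hmono (mem_Ici.2 hv) (mem_Ici.2 (hv.trans hvw.le)) hvw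
  by_cases hw : 0 ≤ w
  · rw [if_neg hv, if_pos hw]
    push Not at hv
    have h1 := wg_pos h (neg_pos.2 hv)
    have h2 := wg_nonneg h hw
    linarith
  · rw [if_neg hv, if_neg hw]
    push Not at hv hw
    have := hmono (mem_Ici.2 (neg_nonneg.2 hw.le)) (mem_Ici.2 (neg_nonneg.2 hv.le)) (neg_lt_neg hvw)
    linarith

/-- On the closed core the contraction is affine with slope `s`. -/
theorem wk_eq_core {v : ℝ} (hv : |v| ≤ ℓ) : wk ℓ ρ s v = s * v := by
  have ⟨hℓ, hρ, hs0, hs1⟩ := h; unfold wk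
  split_ifs
  · exact wg_eq_lo ((le_abs_self v).trans hv)
  · rw [wg_eq_lo ((neg_le_abs v).trans hv)]; ring

/-- Off the window the contraction is the identity. -/
theorem wk_eq_self {v : ℝ} (hv : ρ ≤ |v|) : wk ℓ ρ s v = v := by
  have ⟨hℓ, hρ, hs0, hs1⟩ := h; unfold wk
  split_ifs with h'
  · exact wg_eq_hi h (by rwa [abs_of_nonneg h'] at hv)
  · rw [wg_eq_hi h (by rwa [abs_of_neg (not_le.1 h')] at hv), neg_neg]

/-- `|wk v| = wg |v|`. -/
theorem abs_wk (v : ℝ) : |wk ℓ ρ s v| = wg ℓ ρ s |v| := by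
  have ⟨hℓ, hρ, hs0, hs1⟩ := h; unfold wk
  split_ifs with h'
  · rw [abs_of_nonneg h', abs_of_nonneg (wg_nonneg h h')]
  · push Not at h'
    rw [abs_of_neg h', abs_neg, abs_of_nonneg (wg_nonneg h (neg_nonneg.2 h'.le))]

/-- The contraction moves a point of the closed window by at most its distance to the centre. -/
theorem abs_wk_sub_self_le (v : ℝ) : |wk ℓ ρ s v - v| ≤ |v| := by
  have ⟨hℓ, hρ, hs0, hs1⟩ := h; unfold wk
  split_ifs with h'
  · have h1 := wg_nonneg h h'
    have h2 := wg_le_self h h'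
    rw [abs_of_nonneg h', abs_le]; constructor <;> linarith
  · push Not at h'
    have h1 := wg_nonneg h (neg_nonneg.2 h'.le)
    have h2 := wg_le_self h (neg_nonneg.2 h'.le)
    rw [abs_of_neg h', abs_le]; constructor <;> linarith

/-- The window contraction is surjective. -/
theorem surjective_wk : Function.Surjective (wk ℓ ρ s) := by
  have ⟨hℓ, hρ, hs0, hs1⟩ := h; refine (continuous_wk h).surjective ?_ ?_
  · refine Filter.tendsto_atTop_atTop.2 fun b => ⟨max b ρ, fun v hv => ?_⟩
    have hvρ : ρ ≤ |v| := (le_max_right b ρ).trans (hv.trans (le_abs_self v))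
    rw [wk_eq_self h hvρ]; exact (le_max_left b ρ).trans hv
  · refine Filter.tendsto_atBot_atBot.2 fun b => ⟨min b (-ρ), fun v hv => ?_⟩
    have hvρ : ρ ≤ |v| := by
      have : v ≤ -ρ := hv.trans (min_le_right _ _)
      rw [abs_of_neg (by linarith)]; linarith
    rw [wk_eq_self h hvρ]; exact hv.trans (min_le_left _ _)

/-- Derivative of the window contraction off the break points. -/
theorem hasDerivAt_wk {v : ℝ} (hv1 : |v| ≠ ℓ) (hv2 : |v| ≠ ρ) :
    HasDerivAt (wk ℓ ρ s) (wkD ℓ ρ s v) v := by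
  have ⟨hℓ, hρ, hs0, hs1⟩ := h; have hρ0 : 0 < ρ := by linarith
  have ha1 := one_le_wexp h
  unfold wkD
  by_cases hc : |v| < ℓ
  · rw [if_pos hc]
    have heq : (fun w => s * w) =ᶠ[nhds v] wk ℓ ρ s := by
      filter_upwards [Ioo_mem_nhds (abs_lt.1 hc).1 (abs_lt.1 hc).2] with w hw
      exact (wk_eq_core h (abs_le.2 ⟨hw.1.le, hw.2.le⟩)).symm
    have hd : HasDerivAt (fun w => s * w) s v := by
      simpa using ((hasDerivAt_id v).const_mul s)
    exact HasDerivAt.congr_of_eventuallyEq hd heq.symm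
  rw [if_neg hc]
  have hc' : ℓ < |v| := lt_of_le_of_ne (not_lt.1 hc) (Ne.symm hv1)
  by_cases hb : |v| < ρ
  · rw [if_pos hb]
    rcases le_or_gt 0 v with h0 | h0
    · rw [abs_of_nonneg h0] at hc' hb ⊢
      have heq : (fun w => ρ * (w / ρ) ^ wexp ℓ ρ s) =ᶠ[nhds v] wk ℓ ρ s := by
        filter_upwards [Ioo_mem_nhds hc' hb] with w hw
        show _ = wk ℓ ρ s w
        rw [wk, if_pos (show 0 ≤ w by linarith [hw.1]), wg_eq_mid h hw.1.le hw.2.le]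
      have hd := (((hasDerivAt_id v).div_const ρ).rpow_const (p := wexp ℓ ρ s) (Or.inr ha1)).const_mul ρ
      refine HasDerivAt.congr_of_eventuallyEq (hd.congr_deriv ?_) heq.symm
      simp only [id]; field_simp
    · rw [abs_of_neg h0] at hc' hb ⊢
      have heq : (fun w => -(ρ * (-w / ρ) ^ wexp ℓ ρ s)) =ᶠ[nhds v] wk ℓ ρ s := by
        filter_upwards [Ioo_mem_nhds (show -ρ < v by linarith) (show v < -ℓ by linarith)] with w hw
        show _ = wk ℓ ρ s w
        rw [wk, if_neg (by linarith [hw.2]), wg_eq_mid h (by linarith [hw.2]) (by linarith [hw.1])]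
      have hd := ((((hasDerivAt_id v).neg).div_const ρ).rpow_const (p := wexp ℓ ρ s) (Or.inr ha1)).const_mul ρ
      refine HasDerivAt.congr_of_eventuallyEq (hd.neg.congr_deriv ?_) heq.symm
      simp only [Pi.neg_apply, id_eq, neg_div]; field_simp
  · rw [if_neg hb]
    have hb' : ρ < |v| := lt_of_le_of_ne (not_lt.1 hb) (Ne.symm hv2)
    have heq : (fun w => w) =ᶠ[nhds v] wk ℓ ρ s := by
      rcases le_or_gt 0 v with h0 | h0
      · rw [abs_of_nonneg h0] at hb'
        filter_upwards [Ioi_mem_nhds hb'] with w (hw : ρ < w)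
        exact (wk_eq_self h (hw.le.trans (le_abs_self w))).symm
      · rw [abs_of_neg h0] at hb'
        filter_upwards [Iio_mem_nhds (show v < -ρ by linarith)] with w (hw : w < -ρ)
        refine (wk_eq_self h ?_).symm
        rw [abs_of_neg (by linarith)]; linarith
    exact HasDerivAt.congr_of_eventuallyEq (hasDerivAt_id v) heq.symm

/-- `0 ≤ wk' ≤ a`. -/
theorem wkD_bounds (v : ℝ) : 0 ≤ wkD ℓ ρ s v ∧ wkD ℓ ρ s v ≤ wexp ℓ ρ s := by
  have ⟨hℓ, hρ, hs0, hs1⟩ := h; have hρ0 : 0 < ρ := by linarith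
  have ha1 := one_le_wexp h
  unfold wkD
  split_ifs with h1 h2
  · exact ⟨hs0.le, hs1.trans ha1⟩
  · have hq0 : 0 ≤ |v| / ρ := div_nonneg (abs_nonneg v) hρ0.le
    have hq1 : |v| / ρ ≤ 1 := (div_le_one hρ0).2 h2.le
    have hr := Real.rpow_le_one hq0 hq1 (by linarith : 0 ≤ wexp ℓ ρ s - 1)
    exact ⟨by positivity, by nlinarith [Real.rpow_nonneg hq0 (wexp ℓ ρ s - 1)]⟩
  · exact ⟨zero_le_one, ha1⟩

/-- On the open buffer, `wk' = a · wg(|v|)/|v|`. -/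
theorem wkD_eq_mid {v : ℝ} (h1 : ℓ < |v|) (h2 : |v| < ρ) :
    wkD ℓ ρ s v * |v| = wexp ℓ ρ s * wg ℓ ρ s |v| := by
  have ⟨hℓ, hρ, hs0, hs1⟩ := h; have hρ0 : 0 < ρ := by linarith
  have hv0 : 0 < |v| := hℓ.trans h1
  unfold wkD
  rw [if_neg (not_lt.2 h1.le), if_pos h2, wg_eq_mid h h1.le h2.le,
    Real.rpow_sub_one (div_pos hv0 hρ0).ne']
  field_simp

/-- **Ratio condition** for letters in the half core or far away, off the break points. -/
theorem wk_ratio {v δ : ℝ} (hv1 : |v| ≠ ℓ) (hv2 : |v| ≠ ρ) (hδ : |δ| ≤ ℓ / 2 ∨ 3 * ρ ≤ |δ|) :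
    wkD ℓ ρ s v * |v - δ| ≤ 3 * wexp ℓ ρ s * |wk ℓ ρ s v - wk ℓ ρ s δ| := by
  have ⟨hℓ, hρ, hs0, hs1⟩ := h; have hρ0 : 0 < ρ := by linarith
  have ha1 := one_le_wexp h
  obtain ⟨hD0, hDa⟩ := wkD_bounds h v
  rcases hδ with hδ | hδ
  · -- core letter
    rw [wk_eq_core h (v := δ) (by linarith)]
    by_cases hc : |v| < ℓ
    · have hD : wkD ℓ ρ s v = s := by unfold wkD; rw [if_pos hc]
      rw [hD, wk_eq_core h hc.le, ← mul_sub, abs_mul, abs_of_pos hs0]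
      have : 0 ≤ s * |v - δ| := by positivity
      nlinarith
    have hc' : ℓ < |v| := lt_of_le_of_ne (not_lt.1 hc) (Ne.symm hv1)
    have hkey : |wk ℓ ρ s v| - s * |δ| ≤ |wk ℓ ρ s v - s * δ| := by
      have := abs_sub_abs_le_abs_sub (wk ℓ ρ s v) (s * δ)
      rwa [abs_mul, abs_of_pos hs0] at this
    have htri : |v - δ| ≤ |v| + |δ| := abs_sub v δ
    rw [abs_wk h] at hkey
    by_cases hb : |v| < ρ
    · have hmid := wkD_eq_mid h hc' hb
      have hsl := sl_le_wg h hc'.le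
      have hwg0 : 0 ≤ wg ℓ ρ s |v| := by nlinarith
      -- wkD |v - δ| ≤ wkD (|v| + ℓ/2) ≤ (3/2) wkD |v| = (3/2) a wg ≤ 3 a (wg - s ℓ/2) ≤ 3 a |wk v - s δ|
      have h1 : wkD ℓ ρ s v * |v - δ| ≤ wkD ℓ ρ s v * (3 / 2 * |v|) :=
        mul_le_mul_of_nonneg_left (by linarith) hD0
      have hsδ : s * |δ| ≤ s * (ℓ / 2) := mul_le_mul_of_nonneg_left hδ hs0.le
      have h2' : 2 * (s * |δ|) ≤ wg ℓ ρ s |v| := by linarith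
      have h2 := mul_le_mul_of_nonneg_left h2' (show 0 ≤ wexp ℓ ρ s by linarith)
      have h3 := mul_le_mul_of_nonneg_left hkey (show 0 ≤ 3 * wexp ℓ ρ s by linarith)
      calc wkD ℓ ρ s v * |v - δ| ≤ 3 / 2 * (wkD ℓ ρ s v * |v|) := by linarith
        _ = 3 / 2 * (wexp ℓ ρ s * wg ℓ ρ s |v|) := by rw [hmid]
        _ ≤ 3 * wexp ℓ ρ s * (wg ℓ ρ s |v| - s * |δ|) := by linarith
        _ ≤ 3 * wexp ℓ ρ s * |wk ℓ ρ s v - s * δ| := h3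
    · have hb' : ρ < |v| := lt_of_le_of_ne (not_lt.1 hb) (Ne.symm hv2)
      have hD : wkD ℓ ρ s v = 1 := by unfold wkD; rw [if_neg hc, if_neg hb]
      rw [wk_eq_self h hb'.le] at hkey ⊢
      rw [wg_eq_hi h hb'.le] at hkey
      rw [hD, one_mul]
      have hs' : s * |δ| ≤ |δ| := by nlinarith [abs_nonneg δ]
      have h4 : |v| - ℓ / 2 ≤ |v - s * δ| := by linarith
      have h5 : 0 ≤ |v - s * δ| := abs_nonneg _
      calc |v - δ| ≤ 3 * |v - s * δ| := by linarith
        _ ≤ 3 * wexp ℓ ρ s * |v - s * δ| := by nlinarith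
  · -- far letter
    have hδρ : ρ ≤ |δ| := by linarith
    rw [wk_eq_self h hδρ]
    by_cases hb : |v| < ρ
    · have hmove := abs_wk_sub_self_le h v
      have h1 : |v - δ| - |wk ℓ ρ s v - v| ≤ |wk ℓ ρ s v - δ| := by
        have := abs_sub_abs_le_abs_sub (v - δ) (v - wk ℓ ρ s v)
        rwa [show v - δ - (v - wk ℓ ρ s v) = wk ℓ ρ s v - δ by ring,
          abs_sub_comm v (wk ℓ ρ s v)] at this
      have h2 : |δ| - |v| ≤ |v - δ| := by
        have := abs_sub_abs_le_abs_sub δ v; rwa [abs_sub_comm δ v] at this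
      have h3 : |v - δ| ≤ 2 * |wk ℓ ρ s v - δ| := by linarith
      calc wkD ℓ ρ s v * |v - δ| ≤ wexp ℓ ρ s * |v - δ| :=
            mul_le_mul_of_nonneg_right hDa (abs_nonneg _)
        _ ≤ 3 * wexp ℓ ρ s * |wk ℓ ρ s v - δ| := by nlinarith [abs_nonneg (wk ℓ ρ s v - δ)]
    · have hb' : ρ ≤ |v| := not_lt.1 hb
      have hc : ¬ |v| < ℓ := fun h => hb (by linarith)
      have hD : wkD ℓ ρ s v = 1 := by unfold wkD; rw [if_neg hc, if_neg hb]
      rw [hD, wk_eq_self h hb', one_mul]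
      nlinarith [abs_nonneg (v - δ)]

end Facts

end SepTwo

/-- **Two-scale window contraction** (registered sub-goal of `stub_separateTwo`): for
`0 < ℓ`, `2ℓ ≤ ρ`, `0 < s ≤ 1`, the map `SepTwo.wmap m ℓ ρ s` is a strictly increasing
surjection of `ℝ`, affine with slope `s` on the core `|τ − m| ≤ ℓ`, the identity off the window
`|τ − m| ≥ ρ`, differentiable off `|τ − m| ∈ {ℓ, ρ}` with derivative `SepTwo.wmapD m ℓ ρ s ∈ [0, a]`,
`a = SepTwo.wexp ℓ ρ s = 1 − log s / log(ρ/ℓ) ≥ 1`, and satisfies the ratio condition of the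
comparison lemma with constant `3a` for letters in the half core or at distance `≥ 3ρ`. -/
theorem separateTwo_window (m ℓ ρ s : ℝ) (hℓ : 0 < ℓ) (hρ : 2 * ℓ ≤ ρ) (hs0 : 0 < s) (hs1 : s ≤ 1) : StrictMono (SepTwo.wmap m ℓ ρ s) ∧ Function.Surjective (SepTwo.wmap m ℓ ρ s) ∧ (∀ τ, |τ - m| ≠ ℓ → |τ - m| ≠ ρ → HasDerivAt (SepTwo.wmap m ℓ ρ s) (SepTwo.wmapD m ℓ ρ s τ) τ) ∧ (∀ τ, 0 ≤ SepTwo.wmapD m ℓ ρ s τ ∧ SepTwo.wmapD m ℓ ρ s τ ≤ SepTwo.wexp ℓ ρ s) ∧ (∀ τ γ, |τ - m| ≠ ℓ → |τ - m| ≠ ρ → (|γ - m| ≤ ℓ / 2 ∨ 3 * ρ ≤ |γ - m|) → SepTwo.wmapD m ℓ ρ s τ * |τ - γ| ≤ 3 * SepTwo.wexp ℓ ρ s * |SepTwo.wmap m ℓ ρ s τ - SepTwo.wmap m ℓ ρ s γ|) ∧ (∀ τ, |τ - m| ≤ ℓ → SepTwo.wmap m ℓ ρ s τ = m + s * (τ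 - m)) ∧ (∀ τ, ρ ≤ |τ - m| → SepTwo.wmap m ℓ ρ s τ = τ) ∧ 1 ≤ SepTwo.wexp ℓ ρ s := by
  have h : 0 < ℓ ∧ 2 * ℓ ≤ ρ ∧ 0 < s ∧ s ≤ 1 := ⟨hℓ, hρ, hs0, hs1⟩
  refine ⟨fun τ₁ τ₂ hτ => ?_, fun y => ?_, fun τ h1 h2 => ?_, fun τ => SepTwo.wkD_bounds h _,
    fun τ γ h1 h2 hγ => ?_, fun τ hτ => ?_, fun τ hτ => ?_, SepTwo.one_le_wexp h⟩
  · have := SepTwo.strictMono_wk h (sub_lt_sub_right hτ m)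
    unfold SepTwo.wmap; linarith
  · obtain ⟨v, hv⟩ := SepTwo.surjective_wk h (y - m)
    exact ⟨v + m, by simp [SepTwo.wmap, hv]⟩
  · have h := (SepTwo.hasDerivAt_wk h h1 h2).comp_sub_const τ m
    exact h.const_add m
  · have h := SepTwo.wk_ratio h h1 h2 hγ
    simpa [SepTwo.wmapD, SepTwo.wmap, sub_sub_sub_cancel_right, add_sub_add_left_eq_sub] using h
  · simp [SepTwo.wmap, SepTwo.wk_eq_core h hτ]
  · simp [SepTwo.wmap, SepTwo.wk_eq_self h hτ]

end Summit.KontsevichZagierPeriods.ArrangementNormalForm.JanusBands
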